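import Summits.CriticalPhenomena.Ising3DConformalLimit.Theorems.EnergyNotSigmaSquaredMoebiusLimitExistsPinnedTwoPoint
import Summits.CriticalPhenomena.Ising3DConformalLimit.Theorems.EnergyNotSigmaSquaredMoebiusLimitExistsFreeClusterPointWick
import Summits.CriticalPhenomena.Ising3DConformalLimit.Theorems.EnergyNotSigmaSquaredMoebiusLimitExistsWickPowerMoebius
import Summits.CriticalPhenomena.Ising3DConformalLimit.Theorems.MoebiusLimitExists.Negative.DeltaWindow
import Summits.CriticalPhenomena.Ising3DConformalLimit.Theorems.MoebiusLimitExists.Negative.CruxInversionOnly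
import Summits.CriticalPhenomena.Ising3DConformalLimit.Theorems.MoebiusLimitExists.Negative.PinnedClusterPoints
import Summits.CriticalPhenomena.Ising3DConformalLimit.Theorems.MoebiusLimitOfTwoPointLaw.Negative.TwoPointConvergence
import Summits.CriticalPhenomena.Ising3DConformalLimit.Theses.PerfectScreening
import Summits.CriticalPhenomena.Ising3DConformalLimit.Theses.EnergyNotSigmaSquared
import Literature.Barriers.CriticalPhenomena.BootstrapLatticeBlindness
import HarnessLib

/-!
# The reduction of `MoebiusLimitExists` to its two residues, parametrised by compactness of the pinned zoom
(line `only-interaction-breaks-moebius`, crux `MoebiusLimitExists`, item stmt-CriticalPhenomena-1344, route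
`EnergyNotSigmaSquared`; registered anchor `MoebiusLimitExists_of_residues_cpt`; lead c2, 2026-08-16)

Given the two-point law (the data of item stmt-0634) and sequential compactness of the pinned critical zoom with
regular cluster points (`hcpt` — the conclusion of the landed `pinnedZoom_compactness_of_step` fed with the landed
`pedigreeStep clusterMoveIneq_cubic`; kept as a hypothesis so that this file elaborates against modules already
built on the farm), the crux `MoebiusLimitExists` FOLLOWS from — and, by the refuter's tightness certificates, is
EQUIVALENT to — the conjunction of the line's two registered residues, verbatim:
5′ `stub_interactingInversion_ge_four` and 6′ `stub_interactingUnique_ge_four`.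

* `inversion_identity_of_ge_four_rd` — the inversion identity of a regular cluster point from the identity at even
  orders `≥ 4` (orders `0`, odd, `2` and coincident configurations are free);
* `MoebiusLimitExists_of_residues_cpt` (anchor) — case split on whether some regular cluster point is interacting:
  then 6′ makes it the full pinned limit and 5′ makes it inversion covariant, and `moebiusLimit_iff_inversion`
  (translations, `O(3)`, dilations, `0 < Δ` free) concludes; else every regular cluster point is the Wick power
  family `W_Δ` (`stub_freeClusterPointWick`), the pinned zoom converges to it along the full filter, and `W_Δ` is
  Möbius covariant (`stub_wickPowerMoebius`);
* `interacting_clusterPoint_of_not_crux_cpt` — failure of the crux certifies an interacting regular cluster point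
  (5′ and 6′ hold vacuously when no regular cluster point is interacting);
* `moebiusLimitExists_iff_residues_cpt` — crux ⟺ 5′ ∧ 6′.

The same theorems without `hcpt` (thin glue over `…PinnedZoomCompactness*.lean`) are the registered anchor
`MoebiusLimitExists_of_residues`. References: H. Duminil-Copin, ICM 2022 §8.1, §8.4; M. Aizenman,
H. Duminil-Copin, Ann. Math. 194 (2021) Prop. 7.2. No definitions, no `sorry`.
-/

noncomputable section

open Filter Topology Set Function Metric
open Literature.Probability.LatticeModels
open Literature.Barriers.CriticalPhenomena (hasPointwiseScalingLimit_of_seq_subseq)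

namespace Summit.CriticalPhenomena.Ising3DConformalLimit.MoebiusLimitExistsOnlyInteraction

open Summit.CriticalPhenomena.Ising3DConformalLimit.MoebiusLimitExistsNegative (tendsto_div_succ_nhdsGT)

/-- The value of a cluster point, off the diagonals, at an order where the pinned lattice correlator is a
mesh-independent constant `v` (order `0`: `v = 1`; odd orders: `v = 0`) is `v`. [folklore] -/
theorem IsClusterPoint.eq_const_rd {S : CorrFamily 3} (hS : IsClusterPoint S) {n : ℕ} {v : ℝ}
    (hv : ∀ (δ : ℝ) (y : Fin n → Site 3), rhoPin δ ^ n * criticalCorr 3 n y = v)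
    {x : Fin n → EuclideanSpace ℝ (Fin 3)} (hx : x ∈ NonCoincident 3 n) : S n x = v := by
  obtain ⟨w, -, hconvw⟩ := hS
  have h := (hconvw n).tendsto_at hx
  have h1 : Tendsto (fun k => rescaledCorrelator (criticalCorr 3) rhoPin n (w k) x) atTop (𝓝 v) :=
    tendsto_const_nhds.congr fun k => by rw [rescaledCorrelator_apply, hv]
  exact tendsto_nhds_unique h h1

/-- `ρ_pin(δ)⁰ ⟨1⟩ = 1`. [folklore] -/
theorem rhoPin_pow_mul_criticalCorr_zero_rd (δ : ℝ) (y : Fin 0 → Site 3) :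
    rhoPin δ ^ 0 * criticalCorr 3 0 y = 1 := by
  rw [Summit.CriticalPhenomena.Ising3DConformalLimit.Theorems.MoebiusLimitOfTwoPointLaw.Negative.criticalCorr_arity_zero]
  simp

/-- `ρ_pin(δ)ⁿ ⟨∏σ⟩ = 0` at odd orders (`m*(β_c) = 0` on `ℤ³`). [cite: AizenmanDuminilCopinSidoraviciusCMP2015, Thm. 1.2] -/
theorem rhoPin_pow_mul_criticalCorr_odd_rd (δ : ℝ) {n : ℕ} (hn : Odd n) (y : Fin n → Site 3) :
    rhoPin δ ^ n * criticalCorr 3 n y = 0 := by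
  rw [criticalCorr_eq_zero_of_odd (d := 3) le_rfl hn, mul_zero]

/-- **The inversion identity of a regular cluster point at EVERY order and configuration off the origin, from the
identity at even orders `≥ 4` off the diagonals** (orders `0`, odd and `2` and the coincident configurations are
free; pointwise form of `isInversionCovariant_of_ge_four`). [folklore] -/
theorem inversion_identity_of_ge_four_rd {Δ : ℝ} {S : CorrFamily 3} (hS : IsClusterPoint S)
    (hreg : IsRegular S) (h2 : ∀ x ∈ NonCoincident 3 2, S 2 x = ‖x 0 - x 1‖ ^ (-(2 * Δ)))
    (h5 : ∀ m : ℕ, 2 ≤ m → ∀ x : Fin (2 * m) → EuclideanSpace ℝ (Fin 3), x ∈ NonCoincident 3 (2 * m) →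
      (∀ i, x i ≠ 0) →
      S (2 * m) (fun i => EuclideanGeometry.inversion 0 1 (x i)) = (∏ i, ‖x i‖ ^ (2 * Δ)) * S (2 * m) x)
    (n : ℕ) (x : Fin n → EuclideanSpace ℝ (Fin 3)) (hx0 : ∀ i, x i ≠ 0) :
    S n (fun i => EuclideanGeometry.inversion 0 1 (x i)) = (∏ i, ‖x i‖ ^ (2 * Δ)) * S n x := by
  have hι : Function.Injective (EuclideanGeometry.inversion (0 : EuclideanSpace ℝ (Fin 3)) 1) :=
    EuclideanGeometry.inversion_injective _ one_ne_zero
  have hodd : ∀ n, Odd n → ∀ x, S n x = 0 := by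
    intro n hn x
    by_cases hx : x ∈ NonCoincident 3 n
    · exact hS.eq_const_rd (fun δ y => rhoPin_pow_mul_criticalCorr_odd_rd δ hn y) hx
    · exact hreg.1 n x hx
  rcases Nat.even_or_odd n with ⟨m, hm⟩ | hn
  · obtain rfl : n = 2 * m := by omega
    by_cases hx : x ∈ NonCoincident 3 (2 * m)
    · have hιx : (fun i => EuclideanGeometry.inversion 0 1 (x i)) ∈ NonCoincident 3 (2 * m) :=
        (WickPowerMoebius.comp_mem_nonCoincident_iff hι x).2 hx
      rcases Nat.lt_or_ge m 2 with hm2 | hm2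
      · interval_cases m
        · rw [hS.eq_const_rd rhoPin_pow_mul_criticalCorr_zero_rd hιx, hS.eq_const_rd rhoPin_pow_mul_criticalCorr_zero_rd hx]
          simp
        · rw [h2 _ hιx, h2 _ hx]
          have hk := WickPowerMoebius.powerKernel_inversion Δ (hx0 0) (hx0 1)
          simp only [powerKernel] at hk
          rw [hk, Fin.prod_univ_two]
      · exact h5 m hm2 x hx hx0
    · have hιx : (fun i => EuclideanGeometry.inversion 0 1 (x i)) ∉ NonCoincident 3 (2 * m) :=
        fun h => hx ((WickPowerMoebius.comp_mem_nonCoincident_iff hι x).1 h)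
      rw [hreg.1 _ _ hιx, hreg.1 _ _ hx, mul_zero]
  · rw [hodd n hn, hodd n hn, mul_zero]

/-- **Two cluster points with the same pure-power pair function agreeing at even orders `≥ 4` agree at every order
off the diagonals** (orders `0`, odd, `2` are free). [folklore] -/
theorem IsClusterPoint.eqOn_of_ge_four_rd {Δ : ℝ} {S₁ S₂ : CorrFamily 3} (hS₁ : IsClusterPoint S₁)
    (hS₂ : IsClusterPoint S₂) (h₁ : ∀ x ∈ NonCoincident 3 2, S₁ 2 x = ‖x 0 - x 1‖ ^ (-(2 * Δ)))
    (h₂ : ∀ x ∈ NonCoincident 3 2, S₂ 2 x = ‖x 0 - x 1‖ ^ (-(2 * Δ)))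
    (h6 : ∀ m : ℕ, 2 ≤ m → (NonCoincident 3 (2 * m)).EqOn (S₁ (2 * m)) (S₂ (2 * m))) {n : ℕ}
    {x : Fin n → EuclideanSpace ℝ (Fin 3)} (hx : x ∈ NonCoincident 3 n) : S₁ n x = S₂ n x := by
  rcases Nat.even_or_odd n with ⟨m, hm⟩ | hodd
  · obtain rfl : n = 2 * m := by omega
    rcases Nat.lt_or_ge m 2 with hm2 | hm2
    · interval_cases m
      · exact (hS₁.eq_const_rd rhoPin_pow_mul_criticalCorr_zero_rd hx).trans
          (hS₂.eq_const_rd rhoPin_pow_mul_criticalCorr_zero_rd hx).symm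
      · exact (h₁ x hx).trans (h₂ x hx).symm
    · exact h6 m hm2 hx
  · exact (hS₁.eq_const_rd (fun δ y => rhoPin_pow_mul_criticalCorr_odd_rd δ hodd y) hx).trans
      (hS₂.eq_const_rd (fun δ y => rhoPin_pow_mul_criticalCorr_odd_rd δ hodd y) hx).symm

/-- **Registered anchor `MoebiusLimitExists_of_residues_cpt` — THE REDUCTION OF THE CRUX TO ITS TWO RESIDUES,
parametrised by compactness.** Given the two-point law, sequential compactness of the pinned zoom with regular
cluster points (`hcpt`), the inversion residue 5′ and the uniqueness residue 6′ (both verbatim as registered),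
`MoebiusLimitExists` holds BY NAME. [cite: DuminilCopinICM2022, §8.1 eq. (8.1)–(8.2) and §8.4 p. 29] -/
theorem MoebiusLimitExists_of_residues_cpt :
    ∀ (Δ c : ℝ), 0 < c → Tendsto (fun y : Site 3 => criticalTwoPoint 3 y * Real.sqrt (∑ i, ((y i : ℝ)) ^ 2) ^ (2 * Δ)) cofinite (𝓝 c) → (∀ u : ℕ → ℝ, Tendsto u atTop (𝓝[>] (0 : ℝ)) → ∃ (φ : ℕ → ℕ) (S : CorrFamily 3), StrictMono φ ∧ IsRegular S ∧ ∀ n, TendstoLocallyUniformlyOn (fun k => rescaledCorrelator (criticalCorr 3) rhoPin n (u (φ k))) (S n) atTop (NonCoincident 3 n)) → (∀ (Δ' : ℝ) (S : CorrFamily 3), IsClusterPoint S → IsRegular S → (∀ x ∈ NonCoincident 3 2, S 2 x = ‖x 0 - x 1‖ ^ (-(2 * Δ'))) → HasNontrivialU4 S → ∀ m : ℕ, 2 ≤ m → ∀ x : Fin (2 * m) → EuclideanSpace ℝ (Fin 3), x ∈ NonCoincident 3 (2 * m) → (∀ i, x i ≠ 0) → S (2 * m) (fun i => EuclideanGeometry.inversion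 0 1 (x i)) = (∏ i, ‖x i‖ ^ (2 * Δ')) * S (2 * m) x) → (∀ (Δ' : ℝ) (S₁ S₂ : CorrFamily 3), IsClusterPoint S₁ → IsClusterPoint S₂ → IsRegular S₁ → IsRegular S₂ → (∀ x ∈ NonCoincident 3 2, S₁ 2 x = ‖x 0 - x 1‖ ^ (-(2 * Δ'))) → (∀ x ∈ NonCoincident 3 2, S₂ 2 x = ‖x 0 - x 1‖ ^ (-(2 * Δ'))) → HasNontrivialU4 S₁ → ∀ m : ℕ, 2 ≤ m → (NonCoincident 3 (2 * m)).EqOn (S₁ (2 * m)) (S₂ (2 * m))) → Summit.CriticalPhenomena.Ising3DConformalLimit.Theses.PerfectScreening.MoebiusLimitExists := by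
  intro Δ c hc hG hcpt h5 h6
  have h2 : ∀ S, IsClusterPoint S → ∀ x ∈ NonCoincident 3 2, S 2 x = ‖x 0 - x 1‖ ^ (-(2 * Δ)) :=
    stub_pinnedTwoPoint Δ c hc hG
  by_cases hint : ∃ S₁ : CorrFamily 3, IsClusterPoint S₁ ∧ IsRegular S₁ ∧ HasNontrivialU4 S₁
  · -- INTERACTING BRANCH: `S₁` is the full pinned limit (6′) and inversion covariant (5′)
    obtain ⟨S₁, hS₁, hreg₁, hU₁⟩ := hint
    have hlim : HasPointwiseScalingLimit (criticalCorr 3) rhoPin S₁ := by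
      refine hasPointwiseScalingLimit_of_seq_subseq fun n u hu => ?_
      obtain ⟨φ, S, hφ, hreg, hconv⟩ := hcpt u hu
      have hS : IsClusterPoint S := isClusterPoint_of_subseq hu hφ hconv
      exact ⟨φ, hφ, (hconv n).congr_right fun x hx => (hS₁.eqOn_of_ge_four_rd hS (h2 S₁ hS₁) (h2 S hS)
        (h6 Δ S₁ S hS₁ hS hreg₁ hreg (h2 S₁ hS₁) (h2 S hS) hU₁) hx).symm⟩
    have hinv : IsInversionCovariant Δ S₁ := fun n x hx0 =>
      inversion_identity_of_ge_four_rd hS₁ hreg₁ (h2 S₁ hS₁) (h5 Δ S₁ hS₁ hreg₁ (h2 S₁ hS₁) hU₁) n x hx0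
    exact MoebiusLimitExistsNegative.moebiusLimit_iff_inversion.2
      ⟨rhoPin, Δ, S₁, rhoPin_pos, hlim, isNondegenerateTwoPoint_of_twoPoint (h2 S₁ hS₁), hinv⟩
  · -- FREE BRANCH: every regular cluster point is `W_Δ`, the pinned zoom converges to it
    push Not at hint
    have hW : ∀ S, IsClusterPoint S → IsRegular S → ∀ n, ∀ x ∈ NonCoincident 3 n, S n x = wickPower Δ n x := by
      intro S hS hreg
      refine stub_freeClusterPointWick Δ S hS (h2 S hS) fun z hz => ?_
      by_contra hne
      exact hint S hS hreg ⟨z, hz, hne⟩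
    obtain ⟨φ₀, S₀, hφ₀, hreg₀, hconv₀⟩ := hcpt _ (tendsto_div_succ_nhdsGT one_pos)
    have hS₀ : IsClusterPoint S₀ := isClusterPoint_of_subseq (tendsto_div_succ_nhdsGT one_pos) hφ₀ hconv₀
    have hS₀W : S₀ = wickPower Δ := by
      funext n x
      by_cases hx : x ∈ NonCoincident 3 n
      · exact hW S₀ hS₀ hreg₀ n x hx
      · rw [hreg₀.1 n x hx, wickPower_of_not_mem hx]
    have hM₀ : IsMoebiusCovariant Δ S₀ := by
      rw [hS₀W]
      exact stub_wickPowerMoebius Δ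
    have hlim₀ : HasPointwiseScalingLimit (criticalCorr 3) rhoPin S₀ := by
      refine hasPointwiseScalingLimit_of_seq_subseq fun n u hu => ?_
      obtain ⟨φ, S, hφ, hreg, hconv⟩ := hcpt u hu
      have hS : IsClusterPoint S := isClusterPoint_of_subseq hu hφ hconv
      exact ⟨φ, hφ, (hconv n).congr_right fun x hx => by rw [hW S hS hreg n x hx, hW S₀ hS₀ hreg₀ n x hx]⟩
    exact MoebiusLimitExistsNegative.moebiusLimit_iff_without_delta_pos.2
      ⟨rhoPin, Δ, S₀, rhoPin_pos, hlim₀, isNondegenerateTwoPoint_of_twoPoint (h2 S₀ hS₀), hM₀⟩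

/-- **Failure of the crux certifies interaction**, parametrised by compactness: given the two-point law and
compactness of the pinned zoom, if `MoebiusLimitExists` fails then some regular cluster point of the pinned zoom
has a non-trivial connected four-point function — 5′ and 6′ hold vacuously when no regular cluster point is
interacting. [cite: AizenmanCDM2020, Prop. 7.2 and remark p. 23] -/
theorem interacting_clusterPoint_of_not_crux_cpt {Δ c : ℝ} (hc : 0 < c)
    (hG : Tendsto (fun y : Site 3 => criticalTwoPoint 3 y * Real.sqrt (∑ i, ((y i : ℝ)) ^ 2) ^ (2 * Δ))
      cofinite (𝓝 c))
    (hcpt : ∀ u : ℕ → ℝ, Tendsto u atTop (𝓝[>] (0 : ℝ)) →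
      ∃ (φ : ℕ → ℕ) (S : CorrFamily 3), StrictMono φ ∧ IsRegular S ∧
        ∀ n, TendstoLocallyUniformlyOn (fun k => rescaledCorrelator (criticalCorr 3) rhoPin n (u (φ k)))
          (S n) atTop (NonCoincident 3 n))
    (hnot : ¬ Summit.CriticalPhenomena.Ising3DConformalLimit.Theses.PerfectScreening.MoebiusLimitExists) :
    ∃ S : CorrFamily 3, IsClusterPoint S ∧ IsRegular S ∧ HasNontrivialU4 S := by
  by_contra h
  push Not at h
  refine hnot (MoebiusLimitExists_of_residues_cpt Δ c hc hG hcpt ?_ ?_)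
  · intro Δ' S hS hreg _ hU
    exact absurd hU (h S hS hreg)
  · intro Δ' S₁ S₂ hS₁ _ hreg₁ _ _ _ hU
    exact absurd hU (h S₁ hS₁ hreg₁)

/-- **The crux is EQUIVALENT to the conjunction of its two residues**, given the two-point law and compactness (`⇒`:
the refuter's `PinnedClusterPoints.stub5_of_crux` / `stub6_of_crux`; `⇐`: `MoebiusLimitExists_of_residues_cpt`).
[folklore] -/
theorem moebiusLimitExists_iff_residues_cpt {Δ c : ℝ} (hc : 0 < c)
    (hG : Tendsto (fun y : Site 3 => criticalTwoPoint 3 y * Real.sqrt (∑ i, ((y i : ℝ)) ^ 2) ^ (2 * Δ))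
      cofinite (𝓝 c))
    (hcpt : ∀ u : ℕ → ℝ, Tendsto u atTop (𝓝[>] (0 : ℝ)) →
      ∃ (φ : ℕ → ℕ) (S : CorrFamily 3), StrictMono φ ∧ IsRegular S ∧
        ∀ n, TendstoLocallyUniformlyOn (fun k => rescaledCorrelator (criticalCorr 3) rhoPin n (u (φ k)))
          (S n) atTop (NonCoincident 3 n)) :
    Summit.CriticalPhenomena.Ising3DConformalLimit.Theses.PerfectScreening.MoebiusLimitExists ↔
      ((∀ (Δ' : ℝ) (S : CorrFamily 3), IsClusterPoint S → IsRegular S → (∀ x ∈ NonCoincident 3 2, S 2 x = ‖x 0 - x 1‖ ^ (-(2 * Δ'))) → HasNontrivialU4 S → ∀ m : ℕ, 2 ≤ m → ∀ x : Fin (2 * m) → EuclideanSpace ℝ (Fin 3), x ∈ NonCoincident 3 (2 * m) → (∀ i, x i ≠ 0) → S (2 * m) (fun i => EuclideanGeometry.inversion 0 1 (x i)) = (∏ i, ‖x i‖ ^ (2 * Δ')) * S (2 * m) x) ∧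
        (∀ (Δ' : ℝ) (S₁ S₂ : CorrFamily 3), IsClusterPoint S₁ → IsClusterPoint S₂ → IsRegular S₁ → IsRegular S₂ → (∀ x ∈ NonCoincident 3 2, S₁ 2 x = ‖x 0 - x 1‖ ^ (-(2 * Δ'))) → (∀ x ∈ NonCoincident 3 2, S₂ 2 x = ‖x 0 - x 1‖ ^ (-(2 * Δ'))) → HasNontrivialU4 S₁ → ∀ m : ℕ, 2 ≤ m → (NonCoincident 3 (2 * m)).EqOn (S₁ (2 * m)) (S₂ (2 * m)))) := by
  constructor
  · intro h
    refine ⟨fun Δ' S hS hreg h2 _ m _ x _ hx0 => ?_, fun Δ' S₁ S₂ hS₁ hS₂ _ _ _ _ _ m _ => ?_⟩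
    · exact PinnedClusterPoints.stub5_of_crux h Δ' S hS hreg.1 h2 (2 * m) x hx0
    · exact PinnedClusterPoints.stub6_of_crux h S₁ S₂ hS₁ hS₂ (2 * m)
  · rintro ⟨h5, h6⟩
    exact MoebiusLimitExists_of_residues_cpt Δ c hc hG hcpt h5 h6

end Summit.CriticalPhenomena.Ising3DConformalLimit.MoebiusLimitExistsOnlyInteraction

end
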